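import Mathlib
import Summits.KontsevichZagierPeriods.Zeta5Search.RVLargeParamZCoverHigh
import Summits.KontsevichZagierPeriods.Zeta5Search.ConstantTermFloorWindow
import Summits.KontsevichZagierPeriods.Zeta5Search.ClusterBoundProof
import HarnessLib

/-!
# RVLargeParamMidPoles — anatomy of deficient poles in the large-parameter regime (fam-rv gen 10, file 1; #10.1)

HONEST FRAMING: systematic search; no irrationality claim unless certified.  Pure combinatorics of positions, blocks and
residue classes behind the PROOF of the mid-band node `LargeParamZCoverMidPos` (file 8, `RVLargeParamZCoverBonus.lean`),
completed in files 10.2 (`RVLargeParamMidCases.lean`) and 10.3 (`RVLargeParamZCoverMid.lean`).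
SETTING (`c` = `b` or `b + e_j`): `c` in the polytope, a designated slot `i` with the LEAST lower parameter (`c_i ≤ c_k`), every
other block SHORT (`c₀ − 2c_k < p`); `N = N_p(c)` the pair floors.  Then classes hold at most one pole, positions of depth
`≥ 1` lie in `B_i`, positions outside `B_i` are ZEROS.  Proved here: WILD POLE (`wild_of_classNu_neg`: `ν_x < 0` ⇒ one pole
`q ≥ c_i + p`, `ν_x = E_x`); UNITS (`mul_depth_le_pairFloors`: `c_i + m·p ≤ q ∈ B_i ⇒ m·(depth(q) − 1) ≤ N`;
`six_le_pairFloors_of_long2`); EXTREMAL CLASSES (`netExp_eq_zero_of_classExp_le`); LEVELS of a deficient pole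
(`deficient_pole_level`: `q < c_i + 2p`, `q < 3p`, zero at `q − 2p` — clause (D) of the zero-layer test); LEVEL-ZERO PARTNERS
(`lzd_of_level_zero`, `lzd_mirror_of_inQ`, via the conjugation invariance `classExp_conj`).  Integer bookkeeping only.
-/

noncomputable section

open Finset

namespace Summit.KontsevichZagierPeriods.Zeta5Search.ClusterValuation

open Summit.KontsevichZagierPeriods.Zeta5Search.DualSeries (InBox)
open Summit.KontsevichZagierPeriods.Zeta5Search.WedgeDictionary (dOf)
open Summit.KontsevichZagierPeriods.Zeta5Search.CasoratianValuation (InPolytope pairFloors)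
open Summit.KontsevichZagierPeriods.Zeta5Search.RVFlatGauge.Cap (nbig)

variable {p : ℕ}

/-! ### The outer block `B_i` and the zeros -/

/-- With `c_i` least, a position outside `B_i` lies in no block. -/
theorem blockCount_eq_zero_of_not_mem (c : ℕ → ℤ) (hbox : InBox c) {i : ℕ} (hi : i ∈ range 7)
    (hmin : ∀ k ∈ range 7, c (i + 1) ≤ c (k + 1)) {s : ℕ} (hs : s ∉ blk c i) : blockCount c s = 0 := by
  rw [blockCount_eq, card_eq_zero, filter_eq_empty_iff]
  intro j hj hsj
  exact hs (blk_subset_blk c hbox (mem_range.1 hi) (mem_range.1 hj) (hmin j hj) hsj)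

/-- With `c_i` least, a position outside `B_i` is a ZERO: `netExp ≥ 1`. -/
theorem one_le_netExp_of_not_mem (c : ℕ → ℤ) (hbox : InBox c) {i : ℕ} (hi : i ∈ range 7)
    (hmin : ∀ k ∈ range 7, c (i + 1) ≤ c (k + 1)) {s : ℕ} (hs : s ∉ blk c i) : 1 ≤ netExp c s := by
  unfold netExp
  rw [blockCount_eq_zero_of_not_mem c hbox hi hmin hs]
  split_ifs <;> norm_num

/-- With `c_i` least, a non-positive position lies in `B_i`. -/
theorem mem_blk_of_netExp_le_zero (c : ℕ → ℤ) (hbox : InBox c) {i : ℕ} (hi : i ∈ range 7)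
    (hmin : ∀ k ∈ range 7, c (i + 1) ≤ c (k + 1)) {s : ℕ} (hs : netExp c s ≤ 0) : s ∈ blk c i :=
  mem_largest_of_blockCount c hbox hi hmin (by unfold netExp at hs; split_ifs at hs <;> omega)

/-- A pole of order `≥ 5` has depth `≥ 6`. -/
theorem six_le_blockCount_of_le (c : ℕ → ℤ) {s : ℕ} (hs : netExp c s ≤ -5) : 6 ≤ blockCount c s := by
  unfold netExp at hs; split_ifs at hs <;> omega

/-- A position of depth `7` lies in every block. -/
theorem mem_blk_of_blockCount_eq_seven (c : ℕ → ℤ) {s : ℕ} (hs : blockCount c s = 7) {j : ℕ} (hj : j ∈ range 7) :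
    s ∈ blk c j := by
  rw [blockCount_eq] at hs
  have h : ((range 7).filter fun j => s ∈ blk c j) = range 7 :=
    eq_of_subset_of_card_le (filter_subset _ _) (by rw [hs, card_range])
  have hj' : j ∈ (range 7).filter fun j => s ∈ blk c j := by rw [h]; exact hj
  exact (mem_filter.1 hj').2

/-- A position of depth `≥ 6` misses at most one block: of two distinct blocks it lies in one. -/
theorem mem_or_mem_of_six_le (c : ℕ → ℤ) {s : ℕ} (hs : 6 ≤ blockCount c s) {a a' : ℕ} (ha : a ∈ range 7)
    (ha' : a' ∈ range 7) (hne : a ≠ a') : s ∈ blk c a ∨ s ∈ blk c a' := by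
  by_contra h
  push Not at h
  rw [blockCount_eq] at hs
  have hsub : ((range 7).filter fun j => s ∈ blk c j) ⊆ ((range 7).erase a).erase a' := by
    intro j hj
    rw [mem_filter] at hj
    refine mem_erase.2 ⟨?_, mem_erase.2 ⟨?_, hj.1⟩⟩
    · rintro rfl; exact h.2 hj.2
    · rintro rfl; exact h.1 hj.2
  have hcard : (((range 7).erase a).erase a').card = 5 := by
    rw [card_erase_of_mem (mem_erase.2 ⟨fun e => hne e.symm, ha'⟩), card_erase_of_mem ha, card_range]
  have := card_le_card hsub
  omega

/-! ### Class points at distance `p` -/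

/-- `q + p` is a class point when `q + p ≤ c₀`. -/
theorem add_mem_classSet (c : ℕ → ℤ) {x q : ℕ} (hq : q ∈ classSet c p x) (h : q + p ≤ (c 0).toNat) :
    q + p ∈ classSet c p x := by
  rw [classSet, mem_filter] at hq ⊢
  exact ⟨mem_range.2 (by omega), by rw [Nat.add_mod_right]; exact hq.2⟩

/-- `q − p` is a class point when `p ≤ q`. -/
theorem sub_mem_classSet (c : ℕ → ℤ) {x q : ℕ} (hq : q ∈ classSet c p x) (h : p ≤ q) :
    q - p ∈ classSet c p x := by
  rw [classSet, mem_filter] at hq ⊢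
  have hr := mem_range.1 hq.1
  refine ⟨mem_range.2 (by omega), ?_⟩
  have e : (q - p + p) % p = (q - p) % p := Nat.add_mod_right _ _
  rw [Nat.sub_add_cancel h] at e
  rw [← e]; exact hq.2

/-- In a single-pole class the pole is unique. -/
theorem eq_pole_of_count_one (c : ℕ → ℤ) {x q s : ℕ} (h1 : classPoleCount c p x = 1) (hq : q ∈ classSet c p x)
    (hqp : netExp c q < 0) (hs : s ∈ classSet c p x) (hsp : netExp c s < 0) : s = q := by
  by_contra hne
  have : 1 < classPoleCount c p x := by
    unfold classPoleCount
    exact one_lt_card.2 ⟨q, mem_filter.2 ⟨hq, hqp⟩, s, mem_filter.2 ⟨hs, hsp⟩, fun e => hne e.symm⟩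
  omega

/-! ### Class exponents of single-pole classes -/

/-- `E_x ≥ netExp(q) + netExp(s) + netExp(u)` for the pole `q` and two further distinct points `s, u` of a single-pole class. -/
theorem classExp_ge_pole_add_add (c : ℕ → ℤ) {x q s u : ℕ} (h1 : classPoleCount c p x = 1) (hq : q ∈ classSet c p x)
    (hqp : netExp c q < 0) (hs : s ∈ classSet c p x) (hsq : s ≠ q) (hu : u ∈ classSet c p x) (huq : u ≠ q) (hus : u ≠ s) :
    netExp c q + netExp c s + netExp c u ≤ classExp c p x := by
  unfold classExp
  have hs' : s ∈ (classSet c p x).erase q := mem_erase.2 ⟨hsq, hs⟩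
  have hu' : u ∈ ((classSet c p x).erase q).erase s := mem_erase.2 ⟨hus, mem_erase.2 ⟨huq, hu⟩⟩
  rw [← add_sum_erase _ _ hq, ← add_sum_erase _ _ hs', ← add_sum_erase _ _ hu']
  have h0 : 0 ≤ ∑ v ∈ (((classSet c p x).erase q).erase s).erase u, netExp c v :=
    sum_nonneg fun v hv => netExp_nonneg_of_unique_pole c h1 hq hqp
      (mem_of_mem_erase (mem_of_mem_erase (mem_of_mem_erase hv))) (mem_erase.1 (mem_of_mem_erase (mem_of_mem_erase hv))).1
  have hc : (0 : ℤ) ≤ (if ¬ (2 : ℤ) ∣ c 0 ∧ CentreIn c p x then 1 else 0) := by split_ifs <;> norm_num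
  linarith

/-- **An extremal class**: if `E_x ≤ netExp(q)` for the pole `q` of a single-pole class, every other class point has
`netExp = 0` and the odd-centre correction vanishes. -/
theorem netExp_eq_zero_of_classExp_le (c : ℕ → ℤ) {x q : ℕ} (h1 : classPoleCount c p x = 1) (hq : q ∈ classSet c p x)
    (hqp : netExp c q < 0) (hE : classExp c p x ≤ netExp c q) :
    (∀ s ∈ classSet c p x, s ≠ q → netExp c s = 0) ∧ ¬ (¬ (2 : ℤ) ∣ c 0 ∧ CentreIn c p x) := by
  refine ⟨fun s hs hsq => ?_, fun hcen => ?_⟩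
  · have h := classExp_ge_pole_add c h1 hq hqp hs hsq
    have h0 := netExp_nonneg_of_unique_pole c h1 hq hqp hs hsq
    linarith
  · have hsum : netExp c q ≤ ∑ s ∈ classSet c p x, netExp c s := by
      rw [← add_sum_erase _ _ hq]
      have h0 : 0 ≤ ∑ s ∈ (classSet c p x).erase q, netExp c s :=
        sum_nonneg fun s hs => netExp_nonneg_of_unique_pole c h1 hq hqp (mem_of_mem_erase hs) (mem_erase.1 hs).1
      linarith
    unfold classExp at hE
    rw [if_pos hcen] at hE
    linarith

/-- A class with `E_x < 0` holds a pole. -/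
theorem one_le_classPoleCount_of_classExp_neg (c : ℕ → ℤ) {x : ℕ} (hE : classExp c p x < 0) : 1 ≤ classPoleCount c p x := by
  by_contra h0
  push Not at h0
  have hnone : ∀ s ∈ classSet c p x, 0 ≤ netExp c s := by
    intro s hs
    by_contra hneg
    push Not at hneg
    have : 0 < classPoleCount c p x := by
      unfold classPoleCount; exact card_pos.2 ⟨s, mem_filter.2 ⟨hs, hneg⟩⟩
    omega
  unfold classExp at hE
  have h1 : 0 ≤ ∑ s ∈ classSet c p x, netExp c s := sum_nonneg hnone
  have h2 : (0 : ℤ) ≤ (if ¬ (2 : ℤ) ∣ c 0 ∧ CentreIn c p x then 1 else 0) := by split_ifs <;> norm_num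
  linarith

/-! ### Wild poles and the units they hand out -/

/-- **WILD POLE:** a pole class with `ν_x < 0` is a single-pole class, not tame (`ν_x = E_x`), whose pole `q` has `p ≤ q` and
`c_i + p ≤ q`. -/
theorem wild_of_classNu_neg (c : ℕ → ℤ) (hc : InPolytope c) (hp : 0 < p) {i : ℕ} (hi : i ∈ range 7)
    (hmin : ∀ k ∈ range 7, c (i + 1) ≤ c (k + 1)) (hshort : ∀ k ∈ (range 7).erase i, c 0 - 2 * c (k + 1) < p)
    {x : ℕ} (hpole : 1 ≤ classPoleCount c p x) (hν : classNu c p x < 0) :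
    classPoleCount c p x = 1 ∧ classNu c p x = classExp c p x ∧
      ∃ q ∈ classSet c p x, netExp c q < 0 ∧ p ≤ q ∧ c (i + 1) + p ≤ (q : ℤ) := by
  have hbox : InBox c := hc.1
  have h1 : classPoleCount c p x = 1 := le_antisymm (classPoleCount_le_one_of_short_blocks c hc hp hshort x) hpole
  unfold classNu at hν ⊢
  split_ifs at hν with htame
  · exact absurd hν (not_lt.2 (le_max_right _ _))
  refine ⟨h1, by rw [if_neg htame], ?_⟩
  obtain ⟨q, hq⟩ := card_pos.1 (by unfold classPoleCount at hpole; omega :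
    0 < ((classSet c p x).filter fun s => netExp c s < 0).card)
  rw [mem_filter] at hq
  have hw : ¬ (q < p ∨ ∀ s ∈ classSet c p x, s < q → 0 < netExp c s) := by
    intro hor
    apply htame
    refine ⟨h1, ?_⟩
    unfold tameSingle
    exact decide_eq_true ⟨q, hq.1, hq.2, hor⟩
  push Not at hw
  obtain ⟨hpq, s, hs, hsq, hs0⟩ := hw
  have hsblk : s ∈ blk c i := mem_blk_of_netExp_le_zero c hbox hi hmin hs0
  have hsβ := ((mem_blk c i s).1 hsblk).1
  have hβi0 : 0 ≤ c (i + 1) := (hbox.2 i hi).1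
  have ei : (((c (i + 1)).toNat : ℕ) : ℤ) = c (i + 1) := Int.toNat_of_nonneg hβi0
  have hqs : s + p ≤ q := by
    obtain ⟨m, hm⟩ := dvd_sub_of_mem_classSet c hq.1 hs
    have hm1 : 1 ≤ m := by
      by_contra hm'
      push Not at hm'
      have : (p : ℤ) * m ≤ (p : ℤ) * 0 := mul_le_mul_of_nonneg_left (by omega) (by omega)
      omega
    have : (p : ℤ) * 1 ≤ (p : ℤ) * m := mul_le_mul_of_nonneg_left hm1 (by omega)
    omega
  exact ⟨q, hq.1, hq.2, hpq, by omega⟩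

/-- `m ≤ ⌊(c₀ − c_i − c_k)/p⌋` as soon as `m·p ≤ c₀ − c_i − c_k`. -/
theorem le_pairTerm_of_mul_le (c : ℕ → ℤ) (hp : 0 < p) {i k : ℕ} {m : ℕ}
    (h : (m : ℤ) * p ≤ c 0 - c (i + 1) - c (k + 1)) : (m : ℤ) ≤ pairTerm c p i k := by
  unfold pairTerm
  rw [Int.le_ediv_iff_mul_le (by exact_mod_cast hp)]
  linarith

/-- **THE SHORT STAR of a position `q ∈ B_i` with `c_i + m·p ≤ q`:** the short blocks through `q` form a set `T` with
`#T + 1 = depth(q)`, each giving `m·p ≤ c₀ − c_i − c_k`. -/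
theorem short_star (c : ℕ → ℤ) (hc : InPolytope c) {i : ℕ} (hi : i ∈ range 7) {q m : ℕ} (hqi : q ∈ blk c i)
    (hfar : c (i + 1) + m * p ≤ (q : ℤ)) :
    (∀ k ∈ ((range 7).erase i).filter (fun j => q ∈ blk c j), (m : ℤ) * p ≤ c 0 - c (i + 1) - c (k + 1)) ∧
      (((((range 7).erase i).filter fun j => q ∈ blk c j).card : ℤ) + 1 = blockCount c q) := by
  have hbox : InBox c := hc.1
  set T := ((range 7).erase i).filter (fun j => q ∈ blk c j) with hT
  refine ⟨fun k hk => ?_, ?_⟩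
  · obtain ⟨hk', hqk⟩ := mem_filter.1 hk
    have hk7 := (mem_erase.1 hk').2
    have hβk0 : 0 ≤ c (k + 1) := (hbox.2 k hk7).1
    have h0 : 0 ≤ c 0 := hbox.1
    have e0 : (((c 0).toNat : ℕ) : ℤ) = c 0 := Int.toNat_of_nonneg h0
    have ek : (((c (k + 1)).toNat : ℕ) : ℤ) = c (k + 1) := Int.toNat_of_nonneg hβk0
    have hqk' := ((mem_blk c k q).1 hqk).2
    have h2k : 2 * c (k + 1) ≤ c 0 := hc.2.1 k hk7
    omega
  · have hTe : T = ((range 7).filter fun j => q ∈ blk c j).erase i := by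
      ext j; simp only [hT, mem_filter, mem_erase]; tauto
    have hmem : i ∈ (range 7).filter fun j => q ∈ blk c j := mem_filter.2 ⟨hi, hqi⟩
    rw [hTe, card_erase_of_mem hmem, blockCount_eq]
    have h1c : 1 ≤ ((range 7).filter fun j => q ∈ blk c j).card := card_pos.2 ⟨i, hmem⟩
    omega

/-- **UNITS FROM A FAR POSITION:** `c_i + m·p ≤ q ∈ B_i ⇒ m·(depth(q) − 1) ≤ N_p(c)`. -/
theorem mul_depth_le_pairFloors (c : ℕ → ℤ) (hc : InPolytope c) (hp : 0 < p) {i : ℕ} (hi : i ∈ range 7) {q m : ℕ}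
    (hqi : q ∈ blk c i) (hfar : c (i + 1) + m * p ≤ (q : ℤ)) :
    (m : ℤ) * ((blockCount c q : ℤ) - 1) ≤ pairFloors c p := by
  obtain ⟨hunit, hcount⟩ := short_star c hc hi hqi hfar
  set T := ((range 7).erase i).filter (fun j => q ∈ blk c j) with hT
  have hTsub : T ⊆ (range 7).erase i := filter_subset _ _
  have hsum : ∑ k ∈ T, (m : ℤ) ≤ ∑ k ∈ T, pairTerm c p i k :=
    sum_le_sum fun k hk => le_pairTerm_of_mul_le c hp (hunit k hk)
  have h := hsum.trans (substar_le_pairFloors c hc p hi hTsub)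
  rw [sum_const, nsmul_eq_mul] at h
  have e : (m : ℤ) * ((blockCount c q : ℤ) - 1) = (T.card : ℤ) * m := by rw [← hcount]; ring
  rw [e]; exact h

/-- **`2p ≤ c₀ − 2c_i ⇒ N_p(c) ≥ 6`:** every short block then pairs with `B_i` in a unit. -/
theorem six_le_pairFloors_of_long2 (c : ℕ → ℤ) (hc : InPolytope c) (hp : 0 < p) {i : ℕ} (hi : i ∈ range 7)
    (h2 : 2 * (p : ℤ) ≤ c 0 - 2 * c (i + 1)) : 6 ≤ pairFloors c p := by
  have hall : ∀ k ∈ (range 7).erase i, (p : ℤ) ≤ c 0 - c (i + 1) - c (k + 1) := by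
    intro k hk
    have h2k : 2 * c (k + 1) ≤ c 0 := hc.2.1 k (mem_erase.1 hk).2
    omega
  have hcard : ((range 7).erase i).card = 6 := by rw [card_erase_of_mem hi]; rfl
  have h := card_le_pairFloors_of_units c hc hp hi subset_rfl hall
  rw [hcard] at h
  exact_mod_cast h

/-! ### Levels of a deficient pole (clause (D) of the zero-layer test) -/

/-- **LEVELS OF A DEFICIENT POLE:** a wild pole `q` (`c_i + p ≤ q`) of a single-pole class with `E_x ≤ −5`, under `N_p(c) ≤ 9`,
has `q < c_i + 2p`, `q < 3p`, and a zero at `q − 2p` when `2p ≤ q`. -/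
theorem deficient_pole_level (c : ℕ → ℤ) (hc : InPolytope c) (hp : 0 < p) {i : ℕ} (hi : i ∈ range 7)
    (hmin : ∀ k ∈ range 7, c (i + 1) ≤ c (k + 1)) (hN : pairFloors c p ≤ 9) {x q : ℕ} (h1 : classPoleCount c p x = 1)
    (hq : q ∈ classSet c p x) (hqp : netExp c q < 0) (hwild : c (i + 1) + p ≤ (q : ℤ)) (hE : classExp c p x ≤ -5) :
    (q : ℤ) < c (i + 1) + 2 * p ∧ q < 3 * p ∧ (2 * p ≤ q → 0 < netExp c (q - 2 * p)) := by
  have hbox : InBox c := hc.1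
  have hEq := classExp_ge_pole c h1 hq hqp
  have hdepth : 6 ≤ blockCount c q := six_le_blockCount_of_le c (by linarith)
  have hqi : q ∈ blk c i := mem_blk_of_netExp_le_zero c hbox hi hmin hqp.le
  have hβi0 : 0 ≤ c (i + 1) := (hbox.2 i hi).1
  have ei : (((c (i + 1)).toNat : ℕ) : ℤ) = c (i + 1) := Int.toNat_of_nonneg hβi0
  -- (a) `q < c_i + 2p`: otherwise `2·(depth − 1) ≤ N ≤ 9` with depth `≥ 6`
  have ha : (q : ℤ) < c (i + 1) + 2 * p := by
    by_contra hfar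
    push Not at hfar
    have h := mul_depth_le_pairFloors c hc hp hi (m := 2) hqi (by push_cast; linarith)
    push_cast at h
    have : (6 : ℤ) ≤ blockCount c q := by exact_mod_cast hdepth
    nlinarith
  -- zeros below `c_i`
  have hzero : ∀ s : ℕ, (s : ℤ) < c (i + 1) → 1 ≤ netExp c s := fun s hs =>
    one_le_netExp_of_not_mem c hbox hi hmin fun h => by have := ((mem_blk c i s).1 h).1; omega
  refine ⟨ha, ?_, fun h2 => ?_⟩
  · by_contra h3
    push Not at h3
    have hs2 : q - p - p ∈ classSet c p x := sub_mem_classSet c (sub_mem_classSet c hq (by omega)) (by omega)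
    have hs3 : q - p - p - p ∈ classSet c p x := sub_mem_classSet c hs2 (by omega)
    have hz2 := hzero (q - p - p) (by push_cast [show p + p ≤ q by omega, Nat.sub_sub]; omega)
    have hz3 := hzero (q - p - p - p) (by push_cast [show p + p + p ≤ q by omega, Nat.sub_sub]; omega)
    have h := classExp_ge_pole_add_add c h1 hq hqp hs2 (by omega) hs3 (by omega) (by omega)
    have h6 := netExp_ge_neg_six c q
    linarith
  · have e : q - 2 * p = q - p - p := by omega
    rw [e]
    have := hzero (q - p - p) (by push_cast [show p + p ≤ q by omega, Nat.sub_sub]; omega)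
    omega

/-! ### Level-zero partners -/

/-- **A QUINTIC POLE BELOW `p` IN A CLASS WITH `E ≤ −5` IS A LEVEL-ZERO PARTNER** (`2p ≤ c₀`): `c₀ − s` is a deficient pole. -/
theorem lzd_of_level_zero (c : ℕ → ℤ) (hc : InPolytope c) (hp : 0 < p) {i : ℕ} (hi : i ∈ range 7)
    (hmin : ∀ k ∈ range 7, c (i + 1) ≤ c (k + 1)) (hshort : ∀ k ∈ (range 7).erase i, c 0 - 2 * c (k + 1) < p)
    (hn : 2 * (p : ℤ) ≤ c 0) {s : ℕ} (hsp : s < p) (h5 : netExp c s = -5) (hE : classExp c p s ≤ -5) :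
    lzd c p s = true := by
  have hbox : InBox c := hc.1
  have h0 : 0 ≤ c 0 := hbox.1
  have e0 : (((c 0).toNat : ℕ) : ℤ) = c 0 := Int.toNat_of_nonneg h0
  have hβi0 : 0 ≤ c (i + 1) := (hbox.2 i hi).1
  have ei : (((c (i + 1)).toNat : ℕ) : ℤ) = c (i + 1) := Int.toNat_of_nonneg hβi0
  have hsn : s ≤ (c 0).toNat := by omega
  have hss : s ∈ classSet c p s := mem_filter.2 ⟨mem_range.2 (by omega), rfl⟩
  have h1 : classPoleCount c p s = 1 :=
    le_antisymm (classPoleCount_le_one_of_short_blocks c hc hp hshort s)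
      (by unfold classPoleCount; exact card_pos.2 ⟨s, mem_filter.2 ⟨hss, by omega⟩⟩)
  obtain ⟨hothers, -⟩ := netExp_eq_zero_of_classExp_le c h1 hss (by omega) (by omega)
  -- `s + p` is a class point with `netExp = 0`, hence in `B_i`
  have hsp' : s + p ∈ classSet c p s := add_mem_classSet c hss (by omega)
  have hsp0 : netExp c (s + p) = 0 := hothers _ hsp' (by omega)
  have hspi : s + p ∈ blk c i := mem_blk_of_netExp_le_zero c hbox hi hmin hsp0.le
  have hsptop := ((mem_blk c i (s + p)).1 hspi).2
  -- the mirror pole and its class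
  have hmir5 : netExp c ((c 0).toNat - s) = -5 := by rw [netExp_reflect c h0 hsn]; exact h5
  rw [lzd_iff]
  refine ⟨hsp, h5, hmir5, ?_⟩
  rw [inQ_iff, defClass_iff]
  refine ⟨by rw [hmir5]; norm_num, ?_, ?_⟩
  · rw [show ((c 0).toNat - s) % p = conjClass c p s from rfl, classPoleCount_conj c h0 hsn, h1]
  · rw [show ((c 0).toNat - s) % p = conjClass c p s from rfl]
    have hmem : (c 0).toNat - s ∈ classSet c p (conjClass c p s) :=
      (mem_classSet_conj_iff c hsn (by omega)).2 (by rw [Nat.sub_sub_self hsn]; exact hss)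
    have hmem' : (c 0).toNat - (s + p) ∈ classSet c p (conjClass c p s) :=
      (mem_classSet_conj_iff c hsn (by omega)).2
        (by rw [Nat.sub_sub_self (by omega : s + p ≤ (c 0).toNat)]; exact hsp')
    have hntame : ¬ (classPoleCount c p (conjClass c p s) = 1 ∧ tameSingle c p (conjClass c p s) = true) := by
      rintro ⟨h1', ht⟩
      unfold tameSingle at ht
      obtain ⟨q, hq, hqneg, hor⟩ := of_decide_eq_true ht
      have hqs : q = (c 0).toNat - s := eq_pole_of_count_one c h1' hmem (by omega) hq hqneg
      subst hqs
      rcases hor with hlt | hall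
      · omega
      · have h := hall ((c 0).toNat - (s + p)) hmem' (by omega)
        rw [netExp_reflect c h0 (by omega), hsp0] at h
        exact lt_irrefl _ h
    unfold classNu
    rw [if_neg hntame, classExp_conj c h0 hsn]
    linarith

/-- **SMALL MIRRORS UNDER `N ≤ 5`:** every deficient pole `s` is quintic and `c₀ − s` is a level-zero partner. -/
theorem lzd_mirror_of_inQ (c : ℕ → ℤ) (hc : InPolytope c) (hp : 0 < p) {i : ℕ} (hi : i ∈ range 7)
    (hmin : ∀ k ∈ range 7, c (i + 1) ≤ c (k + 1)) (hshort : ∀ k ∈ (range 7).erase i, c 0 - 2 * c (k + 1) < p)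
    (hN5 : pairFloors c p ≤ 5) {s : ℕ} (hs : s ≤ (c 0).toNat) (hQ : inQ c p s = true) :
    netExp c s = -5 ∧ lzd c p ((c 0).toNat - s) = true := by
  have hbox : InBox c := hc.1
  have h0 : 0 ≤ c 0 := hbox.1
  have e0 : (((c 0).toNat : ℕ) : ℤ) = c 0 := Int.toNat_of_nonneg h0
  have hβi0 : 0 ≤ c (i + 1) := (hbox.2 i hi).1
  have ei : (((c (i + 1)).toNat : ℕ) : ℤ) = c (i + 1) := Int.toNat_of_nonneg hβi0
  obtain ⟨hsneg, hdef⟩ := (inQ_iff c p s).1 hQ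
  obtain ⟨hpole, hν⟩ := (defClass_iff c p (s % p)).1 hdef
  have hsx : s ∈ classSet c p (s % p) := mem_classSet_mod c hs
  obtain ⟨h1, hνE, q, hq, hqp, -, hwild⟩ := wild_of_classNu_neg c hc hp hi hmin hshort hpole (by linarith)
  obtain rfl : s = q := eq_pole_of_count_one c h1 hq hqp hsx hsneg
  have hE : classExp c p (s % p) ≤ -5 := by linarith
  have hEs := classExp_ge_pole c h1 hsx hsneg
  have hsi : s ∈ blk c i := mem_blk_of_netExp_le_zero c hbox hi hmin hsneg.le
  -- depth exactly `6`: a quintic pole off the centre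
  have h6 : 6 ≤ blockCount c s := six_le_blockCount_of_le c (by linarith)
  have hle : (blockCount c s : ℤ) - 1 ≤ 5 := by
    have h := mul_depth_le_pairFloors c hc hp hi (m := 1) hsi (by push_cast; linarith)
    push_cast at h; linarith
  have hbc : blockCount c s = 6 := by omega
  have h5 : netExp c s = -5 := by
    have h7 : -5 ≤ netExp c s := by unfold netExp; rw [hbc]; split_ifs <;> norm_num
    linarith
  refine ⟨h5, ?_⟩
  -- `s + p > c₀`: otherwise `s + p ∈ B_i`, `B_i` is `2p`-long and `N ≥ 6`
  have htop : (c 0).toNat < s + p := by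
    by_contra hle'
    push Not at hle'
    have hmem : s + p ∈ classSet c p (s % p) := add_mem_classSet c hsx hle'
    obtain ⟨hothers, -⟩ := netExp_eq_zero_of_classExp_le c h1 hsx hsneg (by linarith)
    have h0' := hothers _ hmem (by omega)
    have hbi := ((mem_blk c i (s + p)).1 (mem_blk_of_netExp_le_zero c hbox hi hmin h0'.le)).2
    have h6N := six_le_pairFloors_of_long2 c hc hp hi (by omega)
    omega
  rw [lzd_iff]
  refine ⟨by omega, by rw [netExp_reflect c h0 hs]; exact h5, by rw [Nat.sub_sub_self hs]; exact h5,
    by rw [Nat.sub_sub_self hs]; exact hQ⟩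

end Summit.KontsevichZagierPeriods.Zeta5Search.ClusterValuation

end
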